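import Summits.CriticalPhenomena.SAWScalingLimit.Theses.SAWRenewalTightness
import Summits.CriticalPhenomena.SAWScalingLimit.Theorems.SAWRenewalTightnessKestenIdentitySpanRecurrence
import Summits.CriticalPhenomena.SAWScalingLimit.Theorems.SAWRenewalTightnessKestenIdentityRenewal

/-!
# Kesten's criticality identity `Σ_{β irreducible bridge} x_c^{|β|} = 1` (route `SAWRenewalTightness`)

Closes item `stmt-CriticalPhenomena-4733`: the route decl
`Summit.CriticalPhenomena.SAWScalingLimit.Theses.SAWRenewalTightness.KestenIdentity`, i.e.
`HasSum (fun w : {w // SAW.IsIrrBridge w} => SAW.criticalFugacity ^ |w|) 1` on the step-word model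
of `SAWWordBridges.lean` (Madras–Slade (4.2.4); Kesten 1963, §4). Proof, following Madras–Slade
§3.1 and §4.2 with every generating function TRUNCATED to finite sums (no convergence questions):

Part A (vertex-function model on `ℤ^d`, `d ≥ 1`, continuing
`SAWRenewalTightnessKestenIdentitySpanRecurrence.lean`):
* `halfSpaceGF_le_exp` — **`H_M(x) ≤ exp (B_M(x) - 1)`** for `H_M = Σ_{n ≤ M} hₙ xⁿ`,
  `B_M = Σ_{n ≤ M} bₙ xⁿ`, `x ≥ 0`: the finite form of Madras–Slade (3.1.12)–(3.1.13)
  (`Σ h_N z^N ≤ ∏_A (1 + Σ_m b_{m,A} z^m) ≤ e^{B_z - 1}`), by the span recurrence and `1 + t ≤ eᵗ`;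
* `sum_count_mul_pow_le` — `Σ_{n ≤ N} cₙ xⁿ ≤ x⁻¹ H_{N+1}(x)²` from the tree's
  `Zd.count_le_sum_halfSpaceCount` (first line of Madras–Slade (3.1.7));
* **`exists_le_bridgeGF_criticalPoint`** — for every `C` there is `M` with `C ≤ Σ_{n ≤ M} bₙ z_cⁿ`:
  the bridge generating function diverges at `z_c = μ⁻¹` (Madras–Slade Corollary 3.1.8,
  eq. (3.1.11)), because `cₙ z_cⁿ ≥ 1` (`Zd.pow_connectiveConstant_le_count`).

Part B (`ℤ²`, step words):
* `partialSum_le_one` — **`A_{z_c} ≤ 1`**: every finite set `S` of irreducible bridges has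
  `Σ_{s ∈ S} x_c^{|s|} ≤ 1`. Otherwise, by continuity, `Σ_{s ∈ S} ρ^{-|s|} ≥ 1` for some `ρ > μ`, and
  Kesten's renewal lower bound `Renewal.le_connectiveConstant_of_kraft` (unique decoding +
  `bₙ ≤ μⁿ`) gives `ρ ≤ μ`.
* `exists_partialSum_gt` — **`A_{z_c} ≥ 1`**: if all finite partial sums were `≤ A < 1`, the
  truncated renewal inequality (`bridgeGF_le_of_partialSums_le`,
  `SAWRenewalTightnessKestenIdentityRenewal.lean`) would bound `Σ_{n ≤ M} bₙ z_cⁿ ≤ 1/(1 - A)` for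
  all `M`, contradicting Part A.
* `KestenIdentity_proof` — the least upper bound of the finite partial sums is `1`, hence `HasSum`
  (`hasSum_of_isLUB_of_nonneg`).

References: H. Kesten, *On the number of self-avoiding walks*, J. Math. Phys. 4 (1963), §4;
N. Madras, G. Slade, *The Self-Avoiding Walk* (1993), §3.1 (Corollary 3.1.8) and §4.2 (eq. (4.2.4)).
-/

noncomputable section

section PartA

open Finset Literature.Probability.LatticeModels Literature.Probability.Percolation
open Literature.Probability.RandomPlanarGeometry.SAW.Zd
open scoped BigOperators

namespace Summit.CriticalPhenomena.SAWScalingLimit.Theorems.KestenIdentity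

/-! ### `H_M ≤ exp (B_M - 1)` and the divergence of the bridge generating function at `z_c` -/

section GeneratingFunctions

variable {d : ℕ} [NeZero d]

/-- `b₀ = 1`. [cite: MadrasSlade1993, Definition 1.2.4] -/
theorem bridgeCount_zero : bridgeCount d 0 = 1 :=
  le_antisymm ((bridgeCount_le_count 0).trans (count_zero d).le) (one_le_bridgeCount 0)

/-- The bridges of a fixed length with endpoint levels `1, …, S` are at most all of them.
[folklore] -/
theorem sum_card_filter_bridges_le (n S : ℕ) :
    ∑ s ∈ range S, ((bridges d n).filter fun ξ => ξ n 0 = ((s + 1 : ℕ) : ℤ)).card ≤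
      bridgeCount d n := by
  classical
  have hdisj : ∀ s ∈ range S, ∀ t ∈ range S, s ≠ t →
      Disjoint ((bridges d n).filter fun ξ => ξ n 0 = ((s + 1 : ℕ) : ℤ))
        ((bridges d n).filter fun ξ => ξ n 0 = ((t + 1 : ℕ) : ℤ)) := by
    intro s _ t _ hst
    rw [Finset.disjoint_filter]
    intro ξ _ h1 h2
    rw [h1] at h2
    exact hst (by exact_mod_cast Nat.succ_injective (by exact_mod_cast h2))
  rw [← Finset.card_biUnion hdisj, bridgeCount]
  exact Finset.card_le_card (Finset.biUnion_subset.2 fun s _ => Finset.filter_subset _ _)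

/-- The `0`-step bridge has endpoint level `0`, not `s + 1`. [folklore] -/
theorem card_filter_bridges_zero (s : ℕ) :
    ((bridges d 0).filter fun ξ => ξ 0 0 = ((s + 1 : ℕ) : ℤ)).card = 0 := by
  classical
  rw [Finset.card_eq_zero, Finset.filter_eq_empty_iff]
  intro ξ hξ h
  rw [(mem_saws.1 (mem_bridges.1 hξ).1).1] at h
  have : ((0 : Site d) 0) = 0 := rfl
  rw [this] at h
  omega

/-- **`H_M(x) ≤ exp (B_M(x) - 1)`** for the truncated generating functions
`H_M = Σ_{n ≤ M} hₙ xⁿ`, `B_M = Σ_{n ≤ M} bₙ xⁿ` (`x ≥ 0`): the finite form of Madras–Slade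
(3.1.12)–(3.1.13), `Σ_N h_N z^N ≤ ∏_{A ≥ 1} (1 + Σ_m b_{m,A} z^m) ≤ exp (B_z - 1)`, obtained here
from the span recurrence `H_M(≤ S+1) ≤ H_M(≤ S)(1 + B_M(S+1))` and `1 + t ≤ eᵗ`.
[cite: MadrasSlade1993, §3.1 (proof of Corollary 3.1.8, eqs. (3.1.12)–(3.1.13))] -/
theorem halfSpaceGF_le_exp (M : ℕ) {x : ℝ} (hx : 0 ≤ x) :
    ∑ n ∈ range (M + 1), (halfSpaceCount d n : ℝ) * x ^ n ≤
      Real.exp (∑ n ∈ range (M + 1), (bridgeCount d n : ℝ) * x ^ n - 1) := by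
  classical
  set H : ℕ → ℝ := fun S => ∑ n ∈ range (M + 1),
    (((halfSpaceWalks d n).filter fun ω => maxLevel n ω ≤ (S : ℤ)).card : ℝ) * x ^ n with hH
  set B : ℕ → ℝ := fun s => ∑ n ∈ range (M + 1),
    (((bridges d n).filter fun ξ => ξ n 0 = (s : ℤ)).card : ℝ) * x ^ n with hB
  have hrec : ∀ S, H (S + 1) ≤ H S * (1 + B (S + 1)) := by
    intro S
    have e1 : ∀ n, ((halfSpaceWalks d n).filter fun ω => maxLevel n ω ≤ ((S + 1 : ℕ) : ℤ)) =
        (halfSpaceWalks d n).filter fun ω => maxLevel n ω ≤ (S : ℤ) + 1 := fun n =>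
      Finset.filter_congr fun ω _ => by push_cast; exact Iff.rfl
    have e2 : ∀ n, ((bridges d n).filter fun ξ => ξ n 0 = ((S + 1 : ℕ) : ℤ)) =
        (bridges d n).filter fun ξ => ξ n 0 = (S : ℤ) + 1 := fun n =>
      Finset.filter_congr fun ξ _ => by push_cast; exact Iff.rfl
    simp only [hH, hB, e1, e2]
    exact gf_le_gf_mul_one_add (fun n => Nat.cast_nonneg _) (fun n => Nat.cast_nonneg _)
      (fun n => by exact_mod_cast card_filter_maxLevel_le_succ_le (d := d) n S) hx M
  have h0 : H 0 ≤ 1 := by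
    simp only [hH]
    rw [Finset.sum_range_succ', Finset.sum_eq_zero]
    · simp only [pow_zero, mul_one, zero_add, Nat.cast_zero]
      have : ((halfSpaceWalks d 0).filter fun ω => maxLevel 0 ω ≤ ((0 : ℕ) : ℤ)).card ≤
          (saws d 0).card :=
        Finset.card_le_card ((Finset.filter_subset _ _).trans fun ω hω =>
          (mem_halfSpaceWalks.1 hω).1)
      rw [card_saws, count_zero] at this
      exact_mod_cast this
    · intro n _
      rw [mul_eq_zero]; left
      rw [Nat.cast_eq_zero, Finset.card_eq_zero, Finset.filter_eq_empty_iff]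
      intro ω hω hle
      obtain ⟨hs, hh⟩ := mem_halfSpaceWalks.1 hω
      have h1 := hh 1 le_rfl (by omega)
      rw [(mem_saws.1 hs).1] at h1
      have h2 := apply_le_maxLevel ω (show 1 ≤ n + 1 by omega)
      have : ((0 : Site d) 0) = 0 := rfl
      rw [this] at h1
      push_cast at hle
      linarith
  have hle := le_exp_sum_of_succ_le (H := H) (B := B)
    (fun s => Finset.sum_nonneg fun n _ => mul_nonneg (Nat.cast_nonneg _) (pow_nonneg hx n)) h0 hrec M
  -- `H M` is the full half-space generating function
  have hHM : ∑ n ∈ range (M + 1), (halfSpaceCount d n : ℝ) * x ^ n = H M := by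
    simp only [hH]
    refine Finset.sum_congr rfl fun n hn => ?_
    rw [halfSpaceCount, Finset.filter_true_of_mem]
    intro ω hω
    have := (maxLevel_mem_Icc (mem_halfSpaceWalks.1 hω).1).2
    have hnM : (n : ℤ) ≤ M := by exact_mod_cast Nat.le_of_lt_succ (Finset.mem_range.1 hn)
    exact this.trans hnM
  -- `Σ_{s < M} B (s+1) ≤ B_M - 1`
  have hsum : ∑ s ∈ range M, B (s + 1) ≤ ∑ n ∈ range (M + 1), (bridgeCount d n : ℝ) * x ^ n - 1 := by
    simp only [hB]
    rw [Finset.sum_comm, Finset.sum_range_succ', Finset.sum_range_succ' (fun n => (bridgeCount d n : ℝ) * x ^ n)]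
    simp only [card_filter_bridges_zero, Nat.cast_zero, Finset.sum_const_zero, add_zero,
      bridgeCount_zero, Nat.cast_one, pow_zero, mul_one, add_sub_cancel_right]
    refine Finset.sum_le_sum fun n _ => ?_
    rw [← Finset.sum_mul]
    refine mul_le_mul_of_nonneg_right ?_ (pow_nonneg hx _)
    exact_mod_cast sum_card_filter_bridges_le (d := d) (n + 1) M
  rw [hHM]
  exact hle.trans (Real.exp_le_exp.2 hsum)

/-- **`Σ_{n ≤ N} cₙ xⁿ ≤ x⁻¹ · H_{N+1}(x)²`** (`x > 0`), from `cₙ ≤ Σ_{m=0}^{n} h_{m+1} h_{n-m}`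
(`Zd.count_le_sum_halfSpaceCount`). [cite: MadrasSlade1993, §3.1 (eqs. (3.1.7), (3.1.13))] -/
theorem sum_count_mul_pow_le (N : ℕ) {x : ℝ} (hx : 0 < x) :
    ∑ n ∈ range (N + 1), (count d n : ℝ) * x ^ n ≤
      x⁻¹ * (∑ n ∈ range (N + 2), (halfSpaceCount d n : ℝ) * x ^ n) ^ 2 := by
  set a : ℕ → ℝ := fun m => (halfSpaceCount d (m + 1) : ℝ) * x ^ (m + 1) with ha
  set b : ℕ → ℝ := fun k => (halfSpaceCount d k : ℝ) * x ^ k with hb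
  have ha0 : ∀ m, 0 ≤ a m := fun m => mul_nonneg (Nat.cast_nonneg _) (pow_nonneg hx.le _)
  have hb0 : ∀ k, 0 ≤ b k := fun k => mul_nonneg (Nat.cast_nonneg _) (pow_nonneg hx.le _)
  have key : ∀ n ∈ range (N + 1), (count d n : ℝ) * x ^ n ≤
      x⁻¹ * ∑ m ∈ range (n + 1), a m * b (n - m) := by
    intro n _
    have h1 : (count d n : ℝ) ≤
        ∑ m ∈ range (n + 1), (halfSpaceCount d (m + 1) : ℝ) * halfSpaceCount d (n - m) := by
      exact_mod_cast count_le_sum_halfSpaceCount (d := d) n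
    have h2 : x⁻¹ * ∑ m ∈ range (n + 1), a m * b (n - m) =
        (∑ m ∈ range (n + 1), (halfSpaceCount d (m + 1) : ℝ) * halfSpaceCount d (n - m)) * x ^ n := by
      rw [Finset.sum_mul, Finset.mul_sum]
      refine Finset.sum_congr rfl fun m hm => ?_
      have hmn := Nat.le_of_lt_succ (Finset.mem_range.1 hm)
      have : x ^ n = x⁻¹ * (x ^ (m + 1) * x ^ (n - m)) := by
        rw [← pow_add, show m + 1 + (n - m) = n + 1 by omega, pow_succ, mul_comm (x ^ n) x,
          inv_mul_cancel_left₀ hx.ne']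
      simp only [ha, hb]
      rw [this]; ring
    rw [h2]
    exact mul_le_mul_of_nonneg_right h1 (pow_nonneg hx.le n)
  calc ∑ n ∈ range (N + 1), (count d n : ℝ) * x ^ n
      ≤ ∑ n ∈ range (N + 1), x⁻¹ * ∑ m ∈ range (n + 1), a m * b (n - m) := Finset.sum_le_sum key
    _ = x⁻¹ * ∑ n ∈ range (N + 1), ∑ m ∈ range (n + 1), a m * b (n - m) := by rw [Finset.mul_sum]
    _ ≤ x⁻¹ * ((∑ m ∈ range (N + 1), a m) * ∑ k ∈ range (N + 1), b k) :=
        mul_le_mul_of_nonneg_left (sum_range_sum_range_mul_le a b ha0 hb0 N) (inv_nonneg.2 hx.le)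
    _ ≤ x⁻¹ * ((∑ n ∈ range (N + 2), b n) * ∑ n ∈ range (N + 2), b n) := by
        refine mul_le_mul_of_nonneg_left (mul_le_mul ?_ ?_ (Finset.sum_nonneg fun k _ => hb0 k)
          (Finset.sum_nonneg fun n _ => hb0 n)) (inv_nonneg.2 hx.le)
        · rw [Finset.sum_range_succ' b (N + 1)]
          exact le_add_of_nonneg_right (hb0 0)
        · rw [Finset.sum_range_succ b (N + 1)]
          exact le_add_of_nonneg_right (hb0 _)
    _ = x⁻¹ * (∑ n ∈ range (N + 2), (halfSpaceCount d n : ℝ) * x ^ n) ^ 2 := by rw [sq]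

/-- **The bridge generating function diverges at `z_c`** (Madras–Slade, Corollary 3.1.8,
eq. (3.1.11): `Σ_N b_N μ^{-N} = +∞`), in finite form: the truncated sums `Σ_{n ≤ M} bₙ z_cⁿ` are
unbounded. Proof: `N + 1 ≤ Σ_{n ≤ N} cₙ z_cⁿ` (`μⁿ ≤ cₙ`), `≤ z_c⁻¹ H_{N+1}(z_c)²`,
`≤ z_c⁻¹ exp (2 (B_{N+1}(z_c) - 1))`. [cite: MadrasSlade1993, Corollary 3.1.8] -/
theorem exists_le_bridgeGF_criticalPoint (C : ℝ) :
    ∃ M : ℕ, C ≤ ∑ n ∈ range (M + 1), (bridgeCount d n : ℝ) * criticalPoint d ^ n := by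
  set z := criticalPoint d with hz
  have hμ := connectiveConstant_pos d
  have hz0 : 0 < z := inv_pos.2 hμ
  -- `cₙ zⁿ ≥ 1`
  have hone : ∀ n, (1 : ℝ) ≤ (count d n : ℝ) * z ^ n := fun n => by
    have h1 := pow_connectiveConstant_le_count d n
    have h2 : connectiveConstant d ^ n * z ^ n = 1 := by
      rw [← mul_pow, hz, criticalPoint, mul_inv_cancel₀ hμ.ne', one_pow]
    calc (1 : ℝ) = connectiveConstant d ^ n * z ^ n := h2.symm
      _ ≤ (count d n : ℝ) * z ^ n := mul_le_mul_of_nonneg_right h1 (pow_nonneg hz0.le n)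
  obtain ⟨N, hN⟩ := exists_nat_gt (z⁻¹ * Real.exp (C - 1) ^ 2)
  refine ⟨N + 1, ?_⟩
  by_contra hlt
  rw [not_le] at hlt
  have h1 : ((N : ℝ) + 1) ≤ ∑ n ∈ range (N + 1), (count d n : ℝ) * z ^ n := by
    have := Finset.sum_le_sum fun n (_ : n ∈ range (N + 1)) => hone n
    simpa using this
  have h2 := sum_count_mul_pow_le (d := d) N hz0
  have h3 := halfSpaceGF_le_exp (d := d) (N + 1) hz0.le
  have h4 : (∑ n ∈ range (N + 2), (halfSpaceCount d n : ℝ) * z ^ n) ^ 2 ≤ Real.exp (C - 1) ^ 2 := by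
    refine pow_le_pow_left₀ (Finset.sum_nonneg fun n _ => ?_) (h3.trans ?_) 2
    · exact mul_nonneg (Nat.cast_nonneg _) (pow_nonneg hz0.le n)
    · exact Real.exp_le_exp.2 (by linarith)
  have h5 : ((N : ℝ) + 1) ≤ z⁻¹ * Real.exp (C - 1) ^ 2 :=
    h1.trans (h2.trans (mul_le_mul_of_nonneg_left h4 (inv_nonneg.2 hz0.le)))
  linarith

end GeneratingFunctions

end Summit.CriticalPhenomena.SAWScalingLimit.Theorems.KestenIdentity

end PartA

section PartB

open Finset Filter Topology Literature.Probability.LatticeModels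
open Literature.Probability.RandomPlanarGeometry.SAW
open scoped BigOperators Classical

namespace Summit.CriticalPhenomena.SAWScalingLimit.Theorems

namespace KestenIdentity

/-- The planar connective constant is positive. [cite: MadrasSlade1993, §1.2] -/
theorem connectiveConstant_pos' : 0 < connectiveConstant := by
  rw [← Zd.connectiveConstant_two]; exact Zd.connectiveConstant_pos 2

/-- `x_c = μ⁻¹ ≥ 0`. [cite: MadrasSlade1993, §1.3] -/
theorem criticalFugacity_nonneg : 0 ≤ criticalFugacity :=
  inv_nonneg.2 connectiveConstant_pos'.le

/-- **`A_{z_c} ≤ 1`**: every finite set of irreducible bridges has `Σ x_c^{|s|} ≤ 1` (from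
`bₙ ≤ μⁿ` and unique decoding, packaged in the tree as Kesten's renewal lower bound
`Renewal.le_connectiveConstant_of_kraft`, plus a continuity perturbation `ρ ↓ μ`).
[cite: MadrasSlade1993, §4.2, eqs. (4.2.2)–(4.2.4)] -/
theorem partialSum_le_one (S : Finset (List Step)) (hS : ∀ s ∈ S, IsIrrBridge s) :
    ∑ s ∈ S, criticalFugacity ^ s.length ≤ 1 := by
  set S' := insert [(0 : Step)] S with hS'
  have hS'adm : Renewal.Admissible S' := fun s hs => by
    rcases Finset.mem_insert.1 hs with rfl | hs
    · exact Renewal.isIrrBridge_single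
    · exact hS s hs
  have hμ := connectiveConstant_pos'
  -- it suffices to treat `S' ∋ [+e₀]`
  have hle : ∑ s ∈ S, criticalFugacity ^ s.length ≤ ∑ s ∈ S', criticalFugacity ^ s.length :=
    Finset.sum_le_sum_of_subset_of_nonneg (Finset.subset_insert _ _)
      fun s _ _ => pow_nonneg criticalFugacity_nonneg _
  refine hle.trans ?_
  by_contra hgt
  rw [not_le] at hgt
  -- `f ρ = Σ_{s ∈ S'} ρ^{-|s|}` is continuous at `μ`, where it equals the partial sum `> 1`
  set f : ℝ → ℝ := fun ρ => ∑ s ∈ S', ρ⁻¹ ^ s.length with hf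
  have hfμ : f connectiveConstant = ∑ s ∈ S', criticalFugacity ^ s.length := rfl
  have hcont : Tendsto f (𝓝 connectiveConstant) (𝓝 (f connectiveConstant)) :=
    tendsto_finsetSum _ fun s _ => ((continuousAt_inv₀ hμ.ne').tendsto).pow s.length
  have hev : ∀ᶠ ρ in 𝓝 connectiveConstant, 1 < f ρ := hcont.eventually (lt_mem_nhds (hfμ ▸ hgt))
  have hev' : ∀ᶠ ρ in 𝓝[>] connectiveConstant, 1 < f ρ ∧ ρ ∈ Set.Ioi connectiveConstant :=
    (hev.filter_mono nhdsWithin_le_nhds).and self_mem_nhdsWithin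
  obtain ⟨ρ, hρ1, hρ2⟩ := hev'.exists
  rw [Set.mem_Ioi] at hρ2
  have hρ := Renewal.le_connectiveConstant_of_kraft hS'adm (Finset.mem_insert_self _ _)
    (hμ.trans hρ2) hρ1.le
  linarith

/-- **`A_{z_c} ≥ 1`**: for every `A < 1` some finite set of irreducible bridges has
`Σ x_c^{|s|} > A` — otherwise the renewal inequality bounds the truncated bridge generating function
`Σ_{n ≤ M} bₙ z_cⁿ ≤ 1/(1 - A)` uniformly in `M`, contradicting its divergence at `z_c`
(Madras–Slade Corollary 3.1.8). [cite: MadrasSlade1993, §4.2, eq. (4.2.4)] -/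
theorem exists_partialSum_gt {A : ℝ} (hA : A < 1) :
    ∃ S : Finset (List Step), (∀ s ∈ S, IsIrrBridge s) ∧ A < ∑ s ∈ S, criticalFugacity ^ s.length := by
  by_contra h
  push Not at h
  obtain ⟨M, hM⟩ := exists_le_bridgeGF_criticalPoint (d := 2) (1 / (1 - A) + 1)
  rw [Zd.criticalPoint_two] at hM
  have := bridgeGF_le_of_partialSums_le criticalFugacity_nonneg hA h M
  linarith

end KestenIdentity

open KestenIdentity in
/-- **Kesten's criticality identity** `Σ_{β irreducible bridge} x_c^{|β|} = 1` on `ℤ²`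
(Madras–Slade (4.2.4): "`B_z` diverges at `z_c` (Corollary 3.1.8), so in fact `A_{z_c} = 1`"),
as the unconditional sum over the irreducible bridge words of `SAWWordBridges.lean`: the finite
partial sums have least upper bound `1` (Kesten 1963, §4). Closes item `stmt-CriticalPhenomena-4733`.
[cite: MadrasSlade1993, §4.2, eq. (4.2.4)] -/
theorem KestenIdentity_proof :
    Summit.CriticalPhenomena.SAWScalingLimit.Theses.SAWRenewalTightness.KestenIdentity := by
  unfold Summit.CriticalPhenomena.SAWScalingLimit.Theses.SAWRenewalTightness.KestenIdentity
  refine hasSum_of_isLUB_of_nonneg 1 (fun w => pow_nonneg criticalFugacity_nonneg _) ⟨?_, ?_⟩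
  · rintro _ ⟨F, rfl⟩
    have h := partialSum_le_one (F.map (Function.Embedding.subtype _)) fun s hs => by
      obtain ⟨w, -, rfl⟩ := Finset.mem_map.1 hs
      exact w.2
    rwa [Finset.sum_map] at h
  · intro b hb
    by_contra hlt
    rw [not_le] at hlt
    obtain ⟨S, hS, hgt⟩ := exists_partialSum_gt hlt
    have h := hb ⟨S.subtype fun w => IsIrrBridge w, rfl⟩
    dsimp only at h
    have h' : ∑ i ∈ S.subtype (fun w => IsIrrBridge w), criticalFugacity ^ (i : List Step).length =
        ∑ s ∈ S, criticalFugacity ^ s.length :=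
      Finset.sum_subtype_of_mem (fun w : List Step => criticalFugacity ^ w.length) hS
    linarith

end Summit.CriticalPhenomena.SAWScalingLimit.Theorems

end PartB
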